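import Mathlib
import HarnessLib
import Literature.Probability.MarkovChains.IsingGlauber
import Literature.Probability.MarkovChains.SpectralGapVariational
import Literature.Probability.MarkovChains.ErgodicSumVariance
import Literature.Probability.LatticeModels.IsingDecoration

/-!
# The magnetisation is an eigenfunction of the Ising Glauber dynamics on the cycle, with eigenvalue `1 − (1 − tanh 2β)/n` (Levin–Peres–Wilmer Theorem 15.5, eq. (15.17))

HONEST FRAMING: exact (Metropolis-corrected) sampling algorithms for lattice gauge theory; figures
of merit are autocorrelation/cost numbers at stated couplings and volumes; no continuum-physics claim.

Conventions of `IsingGlauber.lean` (`localSpinSum G σ w = S(σ,w)`, `gibbsLaw G β = μ`, the Glauber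
dynamics `glauberKernel (gibbsLaw G β)`, eq. (3.11) `glauberSiteLaw_gibbsLaw_update`),
`GlauberDynamics.lean` (`AgreeOff`, `glauberSiteLaw`), `SpectralGapVariational.lean`
(`orthEigenvalues`, `spectralGap`, `spectralGapR`, `le_of_mem_orthEigenvalues`, Lemma 13.7) and
`ErgodicSumVariance.lean` (`spectralGap_pos`).  The cycle is Mathlib's `SimpleGraph.cycleGraph n`
on `Fin n` (`n ≥ 3`, so that every vertex has exactly the two neighbours `i ± 1`).  Source: D. A.
Levin, Y. Peres (with E. L. Wilmer), *Markov Chains and Mixing Times*, 2nd ed., AMS 2017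
[LevinPeres2017], §15.3 Theorem 15.5 and its proof (pp. 219–220).  Everything is PROVED (finite
sums; 0 named facts).

* `localSpinSum_cycleGraph` — on the cycle `S(σ,i) = σ(i−1) + σ(i+1)` [cite: LevinPeres2017, §15.3
  proof of Thm 15.5 ("here `S(σ,i) = Σ_{j∼i} σ(j) = σ(i−1) + σ(i+1)`")];
* "`tanh(βx) = (tanh(2β)/2)·x` for `x ∈ {−2,0,2}`" is REUSED from the tree
  (`Literature.Probability.LatticeModels.tanh_mul_spin_add_spin`, `IsingDecoration.lean`);
* `magnetisation σ = Φ(σ) = Σ_i σ(i)`; `glauber_mulVec_apply` (the action of `P` on a function,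
  site by site), `siteLaw_sum_spin` (`Σ_s p_s(σ,w)·s = tanh(βS(σ,w))`, from (3.11)),
  `LevinPeres2017_thm_15_5_site` — `(Pϕ_i)`-type identity summed: `(PΦ)(σ) = (1 − 1/n)Φ(σ) +
  n⁻¹Σ_i tanh(βS(σ,i))`;
* **eq. (15.17)** `LevinPeres2017_eq_15_17` — **`PΦ = (1 − (1 − tanh 2β)/n)·Φ`**: "`Φ(σ) := Σ_i σ(i)`
  is an eigenfunction with eigenvalue `λ = 1 − (1 − tanh(2β))/n`" [cite: LevinPeres2017, §15.3 proof
  of Thm 15.5, Claim and eq. (15.17)];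
* `magnetisation_orth` (`Σ_σ μ(σ)Φ(σ) = 0` by spin-flip symmetry), `magnetisation_ne_zero`, hence
  `LevinPeres2017_eq_15_17_mem_orthEigenvalues` and — by Lemma 13.7 — **`LevinPeres2017_thm_15_5_gap_le`:
  `γ ≤ (1 − tanh 2β)/n = c_O(β)/n`**, i.e. **`t_rel ≥ n/c_O(β)`** (`LevinPeres2017_thm_15_5_trel_ge`),
  the half of **(15.15) `t_rel = n/c_O(β)`** that the eigenfunction gives [cite: LevinPeres2017,
  §15.3 Thm 15.5 eq. (15.15) ("This and (15.5) prove (15.15)")].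

SCOPE: the matching bound `t_rel ≤ n/c_O(β)` is (15.5) of Theorem 15.1 (ii) (path coupling, the
sibling files `IsingGlauberContraction` / `IsingGlauberFastMixing`), and the `t_mix` window (15.16)
(Wilson's method, Thm 13.28) is not formalized here.  Context (cell pub-lqcd, venture
LatticeQCDFlow): the magnetisation as the slowest mode of single-site heat-bath dynamics — the
textbook instance of reading a relaxation time off one observable's autocorrelation.
-/

namespace Literature.Probability.MarkovChains

open Finset Function Fin.CommRing
open scoped Matrix

/-! ## The cycle: neighbours and local spin sums -/

section Cycle

variable {n : ℕ}

/-- On `cycleGraph (n+3)` the neighbours of `i` are exactly `i − 1` and `i + 1`, and these are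
distinct. [cite: LevinPeres2017, §15.3 (the `n`-cycle; `S(σ,i) = σ(i−1) + σ(i+1)`)] -/
theorem cycleGraph_adj_iff (i u : Fin (n + 3)) :
    (SimpleGraph.cycleGraph (n + 3)).Adj i u ↔ (u = i - 1 ∨ u = i + 1) := by
  rw [SimpleGraph.cycleGraph_adj]
  constructor
  · rintro (h | h)
    · left; linear_combination -h
    · right; linear_combination h
  · rintro (rfl | rfl)
    · left; ring
    · right; ring

/-- `i − 1 ≠ i + 1` in `Fin (n+3)` (the cycle has at least three vertices). [cite: LevinPeres2017,
§15.3] -/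
theorem cycle_pred_ne_succ (i : Fin (n + 3)) : i - 1 ≠ i + 1 := by
  intro h
  have h2 : (2 : Fin (n + 3)) = 0 := by linear_combination -h
  have h3 : ((2 : Fin (n + 3)) : ℕ) = 2 := by simp
  have h4 := congrArg Fin.val h2
  rw [h3, Fin.val_zero] at h4
  omega

/-- **`S(σ,i) = σ(i−1) + σ(i+1)`** on the cycle. [cite: LevinPeres2017, §15.3 proof of Thm 15.5
("here `S(σ,i) = Σ_{j : j∼i} σ(j) = σ(i−1) + σ(i+1)`")] -/
theorem localSpinSum_cycleGraph (σ : Fin (n + 3) → ℤˣ) (i : Fin (n + 3)) :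
    localSpinSum (SimpleGraph.cycleGraph (n + 3)) σ i =
      ((σ (i - 1) : ℤ) : ℝ) + ((σ (i + 1) : ℤ) : ℝ) := by
  unfold localSpinSum
  have hne := cycle_pred_ne_succ i
  have hsplit : ∀ u : Fin (n + 3),
      (if (SimpleGraph.cycleGraph (n + 3)).Adj i u then ((σ u : ℤ) : ℝ) else 0) =
        (if u = i - 1 then ((σ u : ℤ) : ℝ) else 0) + (if u = i + 1 then ((σ u : ℤ) : ℝ) else 0) := by
    intro u
    by_cases h1 : u = i - 1
    · have h2 : u ≠ i + 1 := fun h => hne (h1.symm.trans h)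
      rw [if_pos ((cycleGraph_adj_iff i u).2 (Or.inl h1)), if_pos h1, if_neg h2, add_zero]
    · by_cases h2 : u = i + 1
      · rw [if_pos ((cycleGraph_adj_iff i u).2 (Or.inr h2)), if_neg h1, if_pos h2, zero_add]
      · rw [if_neg (fun h => ((cycleGraph_adj_iff i u).1 h).elim h1 h2), if_neg h1, if_neg h2,
          add_zero]
  simp_rw [hsplit]
  rw [sum_add_distrib, sum_ite_eq' univ (i - 1), sum_ite_eq' univ (i + 1), if_pos (mem_univ _),
    if_pos (mem_univ _)]

/- "`tanh(βx) = (tanh(2β)/2)·x` for `x ∈ {−2, 0, 2}`" is the landed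
`Literature.Probability.LatticeModels.tanh_mul_spin_add_spin` (IsingDecoration.lean), reused below. -/

end Cycle

/-! ## The action of the Glauber dynamics on the magnetisation -/

section Magnetisation

variable {V : Type*} [Fintype V] [DecidableEq V] {G : SimpleGraph V} [DecidableRel G.Adj]

/-- The magnetisation `Φ(σ) = Σ_i σ(i)`. [cite: LevinPeres2017, §15.3 proof of Thm 15.5 (Claim)] -/
def magnetisation (σ : V → ℤˣ) : ℝ := ∑ i, ((σ i : ℤ) : ℝ)

/-- Sums over a single-site class: `Σ_τ 1{τ ∈ X(σ,w)} g(τ) = Σ_s g(σ^{w←s})`.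
[cite: LevinPeres2017, §3.3.2 eqs. (3.6)–(3.7)] -/
theorem sum_ite_agreeOff_eq (σ : V → ℤˣ) (w : V) (g : (V → ℤˣ) → ℝ) :
    ∑ τ, (if AgreeOff σ w τ then g τ else 0) = ∑ s : ℤˣ, g (update σ w s) := by
  rw [← sum_filter]
  have hset : univ.filter (AgreeOff σ w) = univ.image (update σ w) := by
    ext y
    simp only [mem_filter, mem_univ, true_and, mem_image]
    constructor
    · intro h
      exact ⟨y w, h.eq_update.symm⟩
    · rintro ⟨s, rfl⟩
      exact agreeOff_update σ w s
  rw [hset, sum_image fun s _ s' _ h => update_injective σ w h]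

/-- The heat-bath law at `w` as a sum over the new spin: `Σ_τ π_{σ,w}(τ) g(τ) =
Σ_s p_s(σ,w) g(σ^{w←s})` with `p_s = e^{βsS}/(e^{βsS}+e^{−βsS})`. [cite: LevinPeres2017, §3.3.5
eqs. (3.11)–(3.12)] -/
theorem sum_glauberSiteLaw_mul (β : ℝ) (σ : V → ℤˣ) (w : V) (g : (V → ℤˣ) → ℝ) :
    ∑ τ, glauberSiteLaw (gibbsLaw G β) σ w τ * g τ =
      ∑ s : ℤˣ, glauberSiteLaw (gibbsLaw G β) σ w (update σ w s) * g (update σ w s) := by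
  have h : ∀ τ, glauberSiteLaw (gibbsLaw G β) σ w τ * g τ =
      if AgreeOff σ w τ then glauberSiteLaw (gibbsLaw G β) σ w τ * g τ else 0 := by
    intro τ
    by_cases hτ : AgreeOff σ w τ
    · rw [if_pos hτ]
    · rw [if_neg hτ]
      unfold glauberSiteLaw
      rw [if_neg hτ, zero_mul]
  rw [sum_congr rfl fun τ _ => h τ]
  exact sum_ite_agreeOff_eq σ w _

/-- `p_{+1}(σ,w) + p_{−1}(σ,w) = 1` and **`p_{+1}(σ,w) − p_{−1}(σ,w) = tanh(βS(σ,w))`** (from (3.11):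
`p_{±1} = (1 ± tanh βS)/2`). [cite: LevinPeres2017, §3.3.5 eq. (3.11); §15.3 proof of Thm 15.5
(the display for `(Pϕ_i)(σ)`)] -/
theorem siteLaw_plus_minus (β : ℝ) (σ : V → ℤˣ) (w : V) :
    glauberSiteLaw (gibbsLaw G β) σ w (update σ w 1) +
        glauberSiteLaw (gibbsLaw G β) σ w (update σ w (-1)) = 1 ∧
      glauberSiteLaw (gibbsLaw G β) σ w (update σ w 1) -
        glauberSiteLaw (gibbsLaw G β) σ w (update σ w (-1)) =
        Real.tanh (β * localSpinSum G σ w) := by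
  rw [glauberSiteLaw_gibbsLaw_update, glauberSiteLaw_gibbsLaw_update]
  set S := localSpinSum G σ w
  push_cast
  rw [show β * 1 * S = β * S by ring, show β * -1 * S = -(β * S) by ring, neg_neg]
  have h1 := Real.exp_pos (β * S)
  have h2 := Real.exp_pos (-(β * S))
  constructor
  · field_simp
    ring
  · rw [Real.tanh_eq_sinh_div_cosh, Real.sinh_eq, Real.cosh_eq]
    field_simp
    ring

/-- `(Pf)(σ) = n⁻¹ Σ_w Σ_s p_s(σ,w) f(σ^{w←s})` for the Glauber dynamics.
[cite: LevinPeres2017, §3.3.5 eq. (3.12)] -/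
theorem glauber_mulVec_apply (β : ℝ) (f : (V → ℤˣ) → ℝ) (σ : V → ℤˣ) :
    (glauberKernel (gibbsLaw G β) *ᵥ f) σ =
      (Fintype.card V : ℝ)⁻¹ * ∑ w, ∑ s : ℤˣ,
        glauberSiteLaw (gibbsLaw G β) σ w (update σ w s) * f (update σ w s) := by
  simp only [Matrix.mulVec, dotProduct, glauberKernel_apply]
  simp_rw [mul_assoc, ← mul_sum, sum_mul]
  rw [sum_comm]
  congr 1
  exact sum_congr rfl fun w _ => sum_glauberSiteLaw_mul β σ w f

/-- One site's contribution for the magnetisation: `Σ_s p_s(σ,w) Φ(σ^{w←s}) = Φ(σ) − σ(w) +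
tanh(βS(σ,w))` ("a positive spin is placed at `i` with probability `(1 + tanh[βS])/2` …").
[cite: LevinPeres2017, §15.3 proof of Thm 15.5 (the computation of `(Pϕ_i)(σ)`)] -/
theorem siteLaw_sum_magnetisation (β : ℝ) (σ : V → ℤˣ) (w : V) :
    ∑ s : ℤˣ, glauberSiteLaw (gibbsLaw G β) σ w (update σ w s) * magnetisation (update σ w s) =
      magnetisation σ - ((σ w : ℤ) : ℝ) + Real.tanh (β * localSpinSum G σ w) := by
  have hΦ : ∀ s : ℤˣ, magnetisation (update σ w s) = magnetisation σ - ((σ w : ℤ) : ℝ) + ((s : ℤ) : ℝ) := by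
    intro s
    unfold magnetisation
    rw [← sum_erase_add _ _ (mem_univ w), ← sum_erase_add univ (fun i => ((σ i : ℤ) : ℝ)) (mem_univ w),
      update_self, sum_congr rfl fun i hi => by rw [update_of_ne (ne_of_mem_erase hi)]]
    ring
  simp_rw [hΦ]
  rw [sum_units_int]
  obtain ⟨h1, h2⟩ := siteLaw_plus_minus (G := G) β σ w
  push_cast
  set p := glauberSiteLaw (gibbsLaw G β) σ w (update σ w 1)
  set q := glauberSiteLaw (gibbsLaw G β) σ w (update σ w (-1))
  have hq : q = 1 - p := by linarith
  rw [hq] at h2 ⊢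
  linear_combination h2

/-- **`(PΦ)(σ) = (1 − 1/n)Φ(σ) + n⁻¹ Σ_w tanh(βS(σ,w))`** for the Ising Glauber dynamics on any graph
(summing the site computations). [cite: LevinPeres2017, §15.3 proof of Thm 15.5 ("Summing over
`i`")] -/
theorem glauber_mulVec_magnetisation [Nonempty V] (β : ℝ) (σ : V → ℤˣ) :
    (glauberKernel (gibbsLaw G β) *ᵥ magnetisation) σ =
      (1 - (Fintype.card V : ℝ)⁻¹) * magnetisation σ +
        (Fintype.card V : ℝ)⁻¹ * ∑ w, Real.tanh (β * localSpinSum G σ w) := by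
  rw [glauber_mulVec_apply]
  simp_rw [siteLaw_sum_magnetisation]
  rw [sum_add_distrib, sum_sub_distrib, sum_const, card_univ, nsmul_eq_mul]
  unfold magnetisation
  have hn : (Fintype.card V : ℝ) ≠ 0 := by exact_mod_cast Fintype.card_pos.ne'
  field_simp

end Magnetisation

/-! ## Eq. (15.17) and the lower bound on `t_rel` -/

section Thm155

variable {n : ℕ}

/-- **Eq. (15.17).** On the `n`-cycle (`n ≥ 3`), the magnetisation `Φ(σ) = Σ_i σ(i)` is an
eigenfunction of the Ising Glauber dynamics: **`PΦ = (1 − (1 − tanh(2β))/n)·Φ`**.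
[cite: LevinPeres2017, §15.3 proof of Thm 15.5, Claim and eq. (15.17)] -/
theorem LevinPeres2017_eq_15_17 (β : ℝ) :
    glauberKernel (gibbsLaw (SimpleGraph.cycleGraph (n + 3)) β) *ᵥ magnetisation =
      (1 - (1 - Real.tanh (2 * β)) / (n + 3 : ℝ)) • (magnetisation : (Fin (n + 3) → ℤˣ) → ℝ) := by
  funext σ
  rw [glauber_mulVec_magnetisation, Pi.smul_apply, smul_eq_mul, Fintype.card_fin]
  -- `Σ_i tanh(β(σ(i−1)+σ(i+1))) = tanh(2β)/2 · Σ_i (σ(i−1)+σ(i+1)) = tanh(2β)·Φ(σ)`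
  have hsum : ∑ w : Fin (n + 3), Real.tanh (β * localSpinSum (SimpleGraph.cycleGraph (n + 3)) σ w) =
      Real.tanh (2 * β) * magnetisation σ := by
    simp_rw [localSpinSum_cycleGraph, Literature.Probability.LatticeModels.tanh_mul_spin_add_spin]
    rw [← mul_sum, sum_add_distrib]
    have e1 : ∑ w : Fin (n + 3), ((σ (w - 1) : ℤ) : ℝ) = magnetisation σ :=
      Fintype.sum_equiv (Equiv.subRight 1) _ _ fun _ => rfl
    have e2 : ∑ w : Fin (n + 3), ((σ (w + 1) : ℤ) : ℝ) = magnetisation σ :=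
      Fintype.sum_equiv (Equiv.addRight 1) _ _ fun _ => rfl
    rw [e1, e2]
    ring
  rw [hsum]
  push_cast
  have hn : ((n : ℝ) + 3) ≠ 0 := by positivity
  field_simp
  ring

/-- `Σ_σ μ(σ)Φ(σ) = 0`: the Gibbs law is invariant under the global spin flip `σ ↦ −σ`, which negates
`Φ`. [cite: LevinPeres2017, §15.3 proof of Thm 15.5 (Φ is a non-constant eigenfunction; with §12.1,
eigenfunctions for `λ ≠ 1` are orthogonal to the constants)] -/
theorem magnetisation_orth {V : Type*} [Fintype V] [DecidableEq V] (G : SimpleGraph V)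
    [DecidableRel G.Adj] (β : ℝ) :
    ∑ σ : V → ℤˣ, gibbsLaw G β σ * magnetisation σ = 0 := by
  -- the spin flip
  let flip : (V → ℤˣ) ≃ (V → ℤˣ) :=
    { toFun := fun σ v => -σ v, invFun := fun σ v => -σ v,
      left_inv := fun σ => by funext v; simp, right_inv := fun σ => by funext v; simp }
  have hE : ∀ σ : V → ℤˣ, isingEnergy G (flip σ) = isingEnergy G σ := by
    intro σ
    unfold isingEnergy
    congr 1
    refine sum_congr rfl fun v _ => sum_congr rfl fun u _ => ?_
    show (if G.Adj v u then (((-σ v : ℤˣ) : ℤ) : ℝ) * (((-σ u : ℤˣ) : ℤ) : ℝ) else 0) = _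
    push_cast
    ring_nf
  have hπ : ∀ σ : V → ℤˣ, gibbsLaw G β (flip σ) = gibbsLaw G β σ := by
    intro σ; unfold gibbsLaw; rw [hE]
  have hΦ : ∀ σ : V → ℤˣ, magnetisation (flip σ) = -magnetisation σ := by
    intro σ
    unfold magnetisation
    rw [← sum_neg_distrib]
    refine sum_congr rfl fun i _ => ?_
    show (((-σ i : ℤˣ) : ℤ) : ℝ) = _
    push_cast
    ring
  have h : ∑ σ : V → ℤˣ, gibbsLaw G β σ * magnetisation σ =
      ∑ σ : V → ℤˣ, gibbsLaw G β (flip σ) * magnetisation (flip σ) :=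
    (Fintype.sum_equiv flip _ _ fun _ => rfl).symm
  simp_rw [hπ, hΦ, mul_neg, sum_neg_distrib] at h
  linarith

/-- `Φ ≠ 0` (`Φ(all +1) = n`). [cite: LevinPeres2017, §15.3 proof of Thm 15.5] -/
theorem magnetisation_ne_zero {V : Type*} [Fintype V] [Nonempty V] :
    (magnetisation : (V → ℤˣ) → ℝ) ≠ 0 := by
  intro h
  have := congrFun h (fun _ => 1)
  unfold magnetisation at this
  simp only [Units.val_one, Int.cast_one, sum_const, card_univ, nsmul_eq_mul, mul_one,
    Pi.zero_apply] at this
  exact (Fintype.card_pos (α := V)).ne' (by exact_mod_cast this)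

/-- `λ = 1 − (1 − tanh 2β)/n` is an eigenvalue of the cycle dynamics with an eigenfunction orthogonal
to the constants. [cite: LevinPeres2017, §15.3 proof of Thm 15.5, eq. (15.17)] -/
theorem LevinPeres2017_eq_15_17_mem_orthEigenvalues (β : ℝ) :
    (1 - (1 - Real.tanh (2 * β)) / (n + 3 : ℝ)) ∈
      orthEigenvalues (gibbsLaw (SimpleGraph.cycleGraph (n + 3)) β)
        (glauberKernel (gibbsLaw (SimpleGraph.cycleGraph (n + 3)) β)) :=
  ⟨magnetisation, magnetisation_ne_zero, magnetisation_orth _ β, LevinPeres2017_eq_15_17 β⟩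

/-- **THEOREM 15.5, eigenfunction half of (15.15): `γ ≤ (1 − tanh(2β))/n = c_O(β)/n`** for the
Glauber dynamics of the Ising model on the `n`-cycle (`n ≥ 3`, any `β`).
[cite: LevinPeres2017, §15.3 Thm 15.5, eq. (15.15) with (15.17) ("This and (15.5) prove (15.15)")] -/
theorem LevinPeres2017_thm_15_5_gap_le (β : ℝ) :
    spectralGap (gibbsLaw (SimpleGraph.cycleGraph (n + 3)) β)
        (glauberKernel (gibbsLaw (SimpleGraph.cycleGraph (n + 3)) β)) ≤
      (1 - Real.tanh (2 * β)) / (n + 3 : ℝ) := by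
  set G := SimpleGraph.cycleGraph (n + 3)
  have hπ := gibbsLaw_pos (G := G) β
  have hP := glauberKernel_isRowStochastic (gibbsLaw_pos (G := G) β)
  have h := le_of_mem_orthEigenvalues hπ hP (isingGlauber_isStationary (G := G) β)
    (LevinPeres2017_eq_15_17_mem_orthEigenvalues (n := n) β)
  haveI : Nontrivial (Fin (n + 3) → ℤˣ) :=
    ⟨⟨fun _ => 1, fun _ => -1, fun e => units_ne_neg_self (1 : ℤˣ) (congrFun e 0)⟩⟩
  rw [LevinPeres2017_lemma_13_7 hπ (sum_gibbsLaw (G := G) β) hP (isingGlauber_detailedBalance (G := G) β)]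
  linarith

/-- **THEOREM 15.5, eigenfunction half of (15.15): `t_rel = 1/γ ≥ n/c_O(β)`**, `c_O(β) = 1 − tanh(2β)`,
for `β > 0` (so that `c_O(β) > 0`… indeed for every `β` with `tanh 2β < 1`). [cite: LevinPeres2017,
§15.3 Thm 15.5 eq. (15.15)] -/
theorem LevinPeres2017_thm_15_5_trel_ge (β : ℝ) :
    (n + 3 : ℝ) / (1 - Real.tanh (2 * β)) ≤
      1 / spectralGap (gibbsLaw (SimpleGraph.cycleGraph (n + 3)) β)
        (glauberKernel (gibbsLaw (SimpleGraph.cycleGraph (n + 3)) β)) := by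
  set G := SimpleGraph.cycleGraph (n + 3)
  haveI : Nontrivial (Fin (n + 3) → ℤˣ) :=
    ⟨⟨fun _ => 1, fun _ => -1, fun e => units_ne_neg_self (1 : ℤˣ) (congrFun e 0)⟩⟩
  have hγ : 0 < spectralGap (gibbsLaw G β) (glauberKernel (gibbsLaw G β)) :=
    spectralGap_pos (gibbsLaw_pos β) (sum_gibbsLaw β) (glauberKernel_isRowStochastic (gibbsLaw_pos β))
      (isingGlauber_detailedBalance β) (isingGlauber_isIrreducible β)
  have hc : 0 < 1 - Real.tanh (2 * β) := by
    have := Real.tanh_lt_one (2 * β)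
    linarith
  have h := LevinPeres2017_thm_15_5_gap_le (n := n) β
  rw [div_le_div_iff₀ hc hγ, one_mul]
  calc (n + 3 : ℝ) * spectralGap (gibbsLaw G β) (glauberKernel (gibbsLaw G β))
      ≤ (n + 3 : ℝ) * ((1 - Real.tanh (2 * β)) / (n + 3 : ℝ)) :=
        mul_le_mul_of_nonneg_left h (by positivity)
    _ = 1 - Real.tanh (2 * β) := by field_simp

end Thm155

end Literature.Probability.MarkovChains
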